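import Summits.CriticalPhenomena.CardyFormulaZ2.Theorems.CardyBoundaryCoulombGasAssembly

/-!
# Stub `stub_rectilinearSandwich` of line `registered` (crux `SimilarityUpgrade`, stmt-CriticalPhenomena-4597)

Route `CardyWhiteToColoured`, sub-problem `CardyFormulaZ2`, crux
`Summit.CriticalPhenomena.CardyFormulaZ2.Theses.CardyWhiteToColoured.SimilarityUpgrade`, line
`registered` (skeleton `Cruxes/SimilarityUpgrade/Lines/birth.lean`), stub A
`stub_rectilinearSandwich`: **closure of the factorisation through the conformal modulus from
rectilinear conformal rectangles to all conformal rectangles.**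

If the bond-`ℤ²` crossing probability of every conformal rectangle converges (to `Φ R`), `f` is
continuous on `(0, 1)` with the duality symmetry `f η + f (1 - η) = 1`, and `Φ R = f (η_R)` for
every RECTILINEAR conformal rectangle `R` (boundary inside finitely many axis-parallel segments)
and every uniformizing datum, then `Φ R = f (η_R)` for EVERY conformal rectangle.

Proof: a port of the tree's Bollobás–Riordan sandwich
`Theorems.RectilinearApproximation.cardyFormulaZ2_of_rectilinearCardy`
(`CardyBoundaryCoulombGasAssembly.lean`) with Cardy's `F` replaced by the abstract `f`; that proof
used exactly two properties of `F`, re-proved here for `f`: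

* `modulus_continuity` — Radó continuity of `f ∘ η` along uniformly close marked loops (the proof
  of `stub_cardyContinuity` with `ContinuousOn.continuousAt` for `f`);
* `exists_shift_flip` — the cyclically re-marked copy `R₂ = (Ω; P₁, P₂, P₃, P₀)`
  (`MarkedDomain.exists_shiftMarks`) has modulus `η_{R₂} = 1 - η_R`
  (`crossRatio_eq_one_sub_of_cyclic_boundaryValues`).

Then, with `L = f (η_R)` and `e > 0`: LOWER — a rectilinear approximant `P`
(`exists_rectilinear_close`) of the lower comparison quad `Q` (`stub_comparisonGeometry`) has
`|f (η_P) - L| ≤ e/3`, `Φ P = f (η_P)` and `bond P δ ≤ bond R δ` for small `δ`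
(`discreteCrossing_subset_of_lower`), so `L - e/3 ≤ Φ P ≤ Φ R` in the limit; UPPER — a
rectilinear approximant `P'` of the upper comparison quad `N` (close to `R₂`) has
`|f (η_{P'}) - (1 - L)| ≤ e/3` (flip + duality symmetry) and `bond R δ ≤ 1 - bond P' δ`
(`bond_le_one_sub_real_openCrossing`, `discreteCrossing_subset_plate`), so
`Φ R ≤ 1 - Φ P' ≤ L + e/3`.

References: B. Bollobás, O. Riordan, *Percolation* (2006), Ch. 7 Lemma 14, Claims 19–20, remark
p. 195; Ch. Pommerenke, *Boundary Behaviour of Conformal Maps* (1992), Thm. 2.11;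
L. V. Ahlfors, *Complex Analysis* (1979), Ch. 3 §3.1.
-/

noncomputable section

namespace Summit.CriticalPhenomena.CardyFormulaZ2.Cruxes.SimilarityUpgrade.Stubs

section Proof

open Set Metric Filter Topology MeasureTheory
open Literature.Probability.LatticeModels Literature.Probability.Percolation
open Literature.Probability.RandomPlanarGeometry
open Summit.CriticalPhenomena.CardyFormulaZ2.Cruxes.LoopsToCrossings.OracleSandwich
  (stub_discreteCrossing_of_pathIn stub_not_discreteCrossing_of_dualPathIn
    stub_comparisonGeometry crossRatio_eq_one_sub_of_cyclic_boundaryValues)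
open Summit.CriticalPhenomena.CardyFormulaZ2.Theorems.RectilinearApproximation
  (discreteCrossing_subset_of_lower discreteCrossing_subset_plate bond_le_one_sub_real_openCrossing)
open UpperHalfPlane (upperHalfPlaneSet)

/-- **Radó continuity of `f ∘ modulus` along uniformly close marked loops.** For `f` continuous on
`(0, 1)`, every conformal rectangle `R` with uniformizing datum `(φ, x)` and every `τ > 0` there
is `ε₀ > 0` such that every conformal rectangle `Q` whose boundary loop is uniformly `ε₀`-close to
that of `R` and whose marks are `ε₀`-close to those of `R` has `|f (η_Q) - f (η_R)| ≤ τ` for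
EVERY uniformizing datum of `Q`. By contradiction: offending `Q_n` at closeness `1/(n+1)`
converge to `R`, so `η_{Q_n} → η_R` (`ConformalRectangle.tendsto_crossRatio_of_tendsto_mark`,
Radó), and `f` is continuous at `η_R ∈ (0, 1)`. (The proof of `stub_cardyContinuity` with `f`
for Cardy's `F`.) [cite: PommerenkeBBCM1992, Thm. 2.11 and Cor. 2.4] -/
theorem modulus_continuity {f : ℝ → ℝ} (hf : ContinuousOn f (Ioo 0 1)) (R : ConformalRectangle)
    (φ : ConformalEquiv upperHalfPlaneSet R.carrier) (x : Fin 4 → ℝ) (hφ : R.IsUniformizing φ x)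
    (τ : ℝ) (hτ : 0 < τ) : ∃ ε₀ : ℝ, 0 < ε₀ ∧
      ∀ (Q : ConformalRectangle), (∀ u : ℝ, dist (Q.boundary u) (R.boundary u) ≤ ε₀) →
        (∀ i : Fin 4, |Q.mark i - R.mark i| ≤ ε₀) →
        ∀ (ψ : ConformalEquiv upperHalfPlaneSet Q.carrier) (y : Fin 4 → ℝ),
          Q.IsUniformizing ψ y → |f (crossRatio y) - f (crossRatio x)| ≤ τ := by
  by_contra hcon
  push Not at hcon
  -- offending rectangles at closeness `1/(n+1)`
  have hseq : ∀ n : ℕ, ∃ Q : ConformalRectangle,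
      (∀ u : ℝ, dist (Q.boundary u) (R.boundary u) ≤ 1 / ((n : ℝ) + 1)) ∧
      (∀ i : Fin 4, |Q.mark i - R.mark i| ≤ 1 / ((n : ℝ) + 1)) ∧
      ∃ (ψ : ConformalEquiv upperHalfPlaneSet Q.carrier) (y : Fin 4 → ℝ),
        Q.IsUniformizing ψ y ∧ τ < |f (crossRatio y) - f (crossRatio x)| :=
    fun n ↦ hcon _ (by positivity)
  choose Q hQb hQm ψ y hψ hbad using hseq
  have hsmall : ∀ ε : ℝ, 0 < ε → ∀ᶠ n : ℕ in atTop, 1 / ((n : ℝ) + 1) < ε := fun ε hε ↦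
    (tendsto_order.1 tendsto_one_div_add_atTop_nhds_zero_nat).2 ε hε
  -- the boundary loops converge uniformly and the marks converge
  have hJ : TendstoUniformly (fun n ↦ (Q n).boundary) R.boundary atTop := by
    rw [Metric.tendstoUniformly_iff]
    intro ε hε
    filter_upwards [hsmall ε hε] with n hn u
    rw [dist_comm]
    exact (hQb n u).trans_lt hn
  have hm : ∀ i, Tendsto (fun n ↦ (Q n).mark i) atTop (𝓝 (R.mark i)) := fun i ↦ by
    rw [Metric.tendsto_nhds]
    intro ε hε
    filter_upwards [hsmall ε hε] with n hn
    rw [Real.dist_eq]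
    exact (hQm n i).trans_lt hn
  -- hence the cross-ratios converge (Radó), and so do the values of `f`
  have hlim : Tendsto (fun n ↦ crossRatio (y n)) atTop (𝓝 (crossRatio x)) :=
    ConformalRectangle.tendsto_crossRatio_of_tendsto_mark hJ hm ψ y hψ φ x hφ
  have hF : ContinuousAt f (crossRatio x) :=
    hf.continuousAt (isOpen_Ioo.mem_nhds (ConformalRectangle.crossRatio_mem_Ioo_of_isUniformizing hφ))
  have hFlim := hF.tendsto.comp hlim
  obtain ⟨n, hn⟩ := (Metric.tendsto_nhds.1 hFlim τ hτ).exists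
  rw [Function.comp_apply, Real.dist_eq] at hn
  exact absurd hn (not_lt.2 (hbad n).le)

/-- Transport of `crossRatio_eq_one_sub_of_cyclic_boundaryValues` along an equality of carriers:
a conformal equivalence `ψ : ℍₒ → S`, `S = Ω`, with boundary values `P₁, P₂, P₃, P₀` at a
strictly monotone (or antitone) tuple `z` has `crossRatio z = 1 - η_R`. [cite: Ahlfors1979, Ch. 3 §3.1 and Ch. 6 §1.1] -/
theorem crossRatio_eq_one_sub_of_carrier_eq (R : ConformalRectangle)
    {φ : ConformalEquiv upperHalfPlaneSet R.carrier} {x : Fin 4 → ℝ} (h : R.IsUniformizing φ x)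
    {S : Set ℂ} (hS : S = R.carrier) (ψ : ConformalEquiv upperHalfPlaneSet S) {z : Fin 4 → ℝ}
    (hz : StrictMono z ∨ StrictAnti z) {p : Fin 4 → ℂ} (hbv : ∀ i, ψ.HasBoundaryValue (z i) (p i))
    (h0 : p 0 = R.pt 1) (h1 : p 1 = R.pt 2) (h2 : p 2 = R.pt 3) (h3 : p 3 = R.pt 0) :
    crossRatio z = 1 - crossRatio x := by
  subst hS
  exact crossRatio_eq_one_sub_of_cyclic_boundaryValues R h ψ hz hbv h0 h1 h2 h3

/-- **Cyclic re-marking flips the modulus.** Every conformal rectangle `R = (Ω; P₀, P₁, P₂, P₃)`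
has a cyclically re-marked copy `R₂ = (Ω; P₁, P₂, P₃, P₀)` (`MarkedDomain.exists_shiftMarks`:
boundary loop `u ↦ R.boundary (u + m₁)`, marks `(0, m₂ - m₁, m₃ - m₁, m₀ + 1 - m₁)`), and for
all uniformizing data `(φ, x)` of `R` and `(φ₂, x₂)` of `R₂`, `η(x₂) = 1 - η(x)`
(`crossRatio_eq_one_sub_of_cyclic_boundaryValues`: Möbius renormalisation of the rotated tuple and
conformal invariance of the cross-ratio). [cite: Ahlfors1979, Ch. 3 §3.1 and Ch. 6 §1.1] -/
theorem exists_shift_flip (R : ConformalRectangle) : ∃ R₂ : ConformalRectangle,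
    (∀ u : ℝ, R₂.boundary u = R.boundary (u + R.mark 1)) ∧
    (∀ i : Fin 4, R₂.mark i = ![0, R.mark 2 - R.mark 1, R.mark 3 - R.mark 1, R.mark 0 + 1 - R.mark 1] i) ∧
    ∀ (φ : ConformalEquiv upperHalfPlaneSet R.carrier) (x : Fin 4 → ℝ)
      (φ₂ : ConformalEquiv upperHalfPlaneSet R₂.carrier) (x₂ : Fin 4 → ℝ),
      R.IsUniformizing φ x → R₂.IsUniformizing φ₂ x₂ → crossRatio x₂ = 1 - crossRatio x := by
  obtain ⟨R', hc, hb, hm, -, -, -, -⟩ := MarkedDomain.exists_shiftMarks R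
  -- the marked points of `R'` are those of `R` shifted by one
  have hpt : ∀ i : Fin 4, R'.pt i = R.pt (i + 1) := by
    intro i
    show R'.boundary (R'.mark i) = R.boundary (R.mark (i + 1))
    rw [hb, hm]
    fin_cases i
    · simp
    · simp
    · simp
    · simp only [Fin.reduceFinMk, Matrix.cons_val, sub_add_cancel, Fin.isValue]
      rw [R.periodic_boundary]
      rfl
  refine ⟨R', hb, hm, fun φ x φ₂ x₂ h h₂ ↦ ?_⟩
  exact crossRatio_eq_one_sub_of_carrier_eq R h hc φ₂ h₂.1 (p := fun i ↦ R'.pt i) h₂.2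
    (hpt 0) (hpt 1) (hpt 2) (hpt 3)

/-- **The rectilinear sandwich** (port of `RectilinearApproximation.cardyFormulaZ2_of_rectilinearCardy`
with the abstract `f` for Cardy's `F`): under full bond-`ℤ²` limits `Φ`, continuity of `f` on
`(0, 1)`, the duality symmetry `f η + f (1 - η) = 1` and the factorisation `Φ = f ∘ η` on
rectilinear conformal rectangles, `Φ R = f (η_R)` for every conformal rectangle `R`.
See the module docstring for the sandwich. [cite: BollobasRiordan2006, Ch. 7 Lemma 14 p. 184, Claims 19–20 p. 192, remark p. 195] -/
theorem factors_of_rectilinear {Φ : ConformalRectangle → ℝ} {f : ℝ → ℝ}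
    (hlim : ∀ R : ConformalRectangle, Tendsto (bondDomainCrossingProb R) (𝓝[>] (0 : ℝ)) (𝓝 (Φ R)))
    (hf : ContinuousOn f (Ioo 0 1)) (hsymm : ∀ η ∈ Ioo (0 : ℝ) 1, f η + f (1 - η) = 1)
    (hfact : ∀ R : ConformalRectangle,
      (∃ S : Finset (ℂ × ℂ), (∀ p ∈ S, p.1.re = p.2.re ∨ p.1.im = p.2.im) ∧
        frontier R.carrier ⊆ ⋃ p ∈ S, segment ℝ p.1 p.2) →
      ∀ (φ : ConformalEquiv upperHalfPlaneSet R.carrier) (x : Fin 4 → ℝ),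
        R.IsUniformizing φ x → Φ R = f (crossRatio x))
    (R : ConformalRectangle) (φ : ConformalEquiv upperHalfPlaneSet R.carrier) (x : Fin 4 → ℝ)
    (hux : R.IsUniformizing φ x) : Φ R = f (crossRatio x) := by
  set L : ℝ := f (crossRatio x) with hL
  -- the cyclically re-marked copy: `f (η_{R₂}) = 1 - L`
  obtain ⟨R₂, hbd, hmk, hflip⟩ := exists_shift_flip R
  obtain ⟨φ₂, x₂, hux₂⟩ := MarkedDomain.exists_isUniformizing_holds R₂
  have hfx₂ : f (crossRatio x₂) = 1 - L := by
    have hs := hsymm (crossRatio x) (ConformalRectangle.crossRatio_mem_Ioo_of_isUniformizing hux)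
    rw [hflip φ x φ₂ x₂ hux hux₂]
    linarith
  -- lower bound
  have hlow : ∀ e : ℝ, 0 < e → L - e ≤ Φ R := by
    intro e he
    obtain ⟨ε₁, hε₁, h1⟩ := modulus_continuity hf R φ x hux (e / 3) (by positivity)
    obtain ⟨m, hm, hgeo⟩ := stub_comparisonGeometry R (ε₁ / 2) (by positivity)
    obtain ⟨δ₀, hδ₀, t₀, ht₀, hAfor⟩ := stub_discreteCrossing_of_pathIn R
    obtain ⟨⟨Q, r, hr, hQb, hQm, hL1, hL2, hL3, hL4⟩, -⟩ := hgeo t₀ ht₀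
    obtain ⟨P, hPmark, hPS, hPclose⟩ :=
      Summit.CriticalPhenomena.CardyFormulaZ2.Theorems.exists_rectilinear_close Q
        (ε := min (ε₁ / 2) (r / 2)) (lt_min (by positivity) (by positivity))
    obtain ⟨ψ, y, hψ⟩ := MarkedDomain.exists_isUniformizing_holds P
    have hF : |f (crossRatio y) - L| ≤ e / 3 := by
      refine h1 P (fun u ↦ ?_) (fun i ↦ ?_) ψ y hψ
      · calc dist (P.boundary u) (R.boundary u)
            ≤ dist (P.boundary u) (Q.boundary u) + dist (Q.boundary u) (R.boundary u) :=
              dist_triangle _ _ _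
          _ ≤ min (ε₁ / 2) (r / 2) + ε₁ / 2 := add_le_add (hPclose u) (hQb u)
          _ ≤ ε₁ := by have := min_le_left (ε₁ / 2) (r / 2); linarith
      · rw [hPmark i]; exact (hQm i).trans (by linarith)
    have hPval : Φ P = f (crossRatio y) := hfact P hPS ψ y hψ
    -- `bond P δ ≤ bond R δ` for small `δ`
    have hev2 : ∀ᶠ δ : ℝ in 𝓝[>] 0, δ ∈ Ioo 0 (min δ₀ (min m (r / 2))) :=
      Ioo_mem_nhdsGT (lt_min hδ₀ (lt_min hm (by positivity)))
    have hev : ∀ᶠ δ : ℝ in 𝓝[>] 0, bondDomainCrossingProb P δ ≤ bondDomainCrossingProb R δ := by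
      filter_upwards [hev2] with δ hδ2
      have hδ₀' : δ < δ₀ := hδ2.2.trans_le (min_le_left _ _)
      have hδm : δ < m := hδ2.2.trans_le ((min_le_right _ _).trans (min_le_left _ _))
      have hδr : δ < r / 2 := hδ2.2.trans_le ((min_le_right _ _).trans (min_le_right _ _))
      have hincl := discreteCrossing_subset_of_lower R Q P hAfor hL1 hL2 hL3 hL4 hPclose hPmark
        (le_min (by positivity) (by positivity)) (min_le_right _ _) hδ2.1 hδ₀' hδm hδr.le ht₀.le
      rw [bondDomainCrossingProb_eq_measureReal, bondDomainCrossingProb_eq_measureReal]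
      exact measureReal_mono hincl
    have hPR : Φ P ≤ Φ R := le_of_tendsto_of_tendsto (hlim P) (hlim R) hev
    have hF' := (abs_sub_le_iff.1 hF).2
    linarith
  -- upper bound
  have hup : ∀ e : ℝ, 0 < e → Φ R ≤ L + e := by
    intro e he
    obtain ⟨ε₂, hε₂, h2⟩ := modulus_continuity hf R₂ φ₂ x₂ hux₂ (e / 3) (by positivity)
    obtain ⟨m, hm, hgeo⟩ := stub_comparisonGeometry R (ε₂ / 2) (by positivity)
    obtain ⟨δ₀, hδ₀, t₀, ht₀, hBfor⟩ := stub_not_discreteCrossing_of_dualPathIn R m hm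
    obtain ⟨-, ⟨N, r, hr, hNb, hNm, hU1, hU2, hU3, hU4, hU5⟩⟩ := hgeo t₀ ht₀
    obtain ⟨P, hPmark, hPS, hPclose⟩ :=
      Summit.CriticalPhenomena.CardyFormulaZ2.Theorems.exists_rectilinear_close N
        (ε := min (ε₂ / 2) (r / 4)) (lt_min (by positivity) (by positivity))
    obtain ⟨ψ, y, hψ⟩ := MarkedDomain.exists_isUniformizing_holds P
    have hF : |f (crossRatio y) - (1 - L)| ≤ e / 3 := by
      rw [← hfx₂]
      refine h2 P (fun u ↦ ?_) (fun i ↦ ?_) ψ y hψ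
      · rw [hbd u]
        calc dist (P.boundary u) (R.boundary (u + R.mark 1))
            ≤ dist (P.boundary u) (N.boundary u) + dist (N.boundary u) (R.boundary (u + R.mark 1)) :=
              dist_triangle _ _ _
          _ ≤ min (ε₂ / 2) (r / 4) + ε₂ / 2 := add_le_add (hPclose u) (hNb u)
          _ ≤ ε₂ := by have := min_le_left (ε₂ / 2) (r / 4); linarith
      · rw [hPmark i, hmk i]; exact (hNm i).trans (by linarith)
    have hPval : Φ P = f (crossRatio y) := hfact P hPS ψ y hψ
    -- `bond R δ ≤ 1 - bond P δ` for small `δ`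
    have hev2 : ∀ᶠ δ : ℝ in 𝓝[>] 0, δ ∈ Ioo 0 (min δ₀ (min (m / 3) (r / 4))) :=
      Ioo_mem_nhdsGT (lt_min hδ₀ (lt_min (by positivity) (by positivity)))
    have hev : ∀ᶠ δ : ℝ in 𝓝[>] 0,
        bondDomainCrossingProb R δ ≤ 1 - bondDomainCrossingProb P δ := by
      filter_upwards [hev2] with δ hδ2
      have hδ₀' : δ < δ₀ := hδ2.2.trans_le (min_le_left _ _)
      have hδm : δ < m / 3 := hδ2.2.trans_le ((min_le_right _ _).trans (min_le_left _ _))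
      have hδr : δ < r / 4 := hδ2.2.trans_le ((min_le_right _ _).trans (min_le_right _ _))
      have hle := bond_le_one_sub_real_openCrossing R hBfor hU1 hU2 hU3 hU4 hU5 hδ2.1 hδ₀'
        (by linarith) (by linarith) ht₀.le le_rfl
      have hincl := discreteCrossing_subset_plate N P hPclose hPmark
        (le_min (by positivity) (by positivity)) (min_le_right _ _) hδ2.1 hδr.le
      have hle' : bondDomainCrossingProb P δ ≤ (bondPercolation (zdGraph 2) half).real
          (openCrossing {x : Site 2 | meshPoint δ x ∈ cthickening (r / 2) N.carrier}
            {x | meshPoint δ x ∈ cthickening (r / 2) (N.arc 0)}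
            {x | meshPoint δ x ∈ cthickening (r / 2) (N.arc 2)}) := by
        rw [bondDomainCrossingProb_eq_measureReal]
        exact measureReal_mono hincl
      linarith
    have hlim' : Tendsto (fun δ ↦ 1 - bondDomainCrossingProb P δ) (𝓝[>] 0) (𝓝 (1 - Φ P)) :=
      (hlim P).const_sub 1
    have hRP : Φ R ≤ 1 - Φ P := le_of_tendsto_of_tendsto (hlim R) hlim' hev
    have hF' := (abs_sub_le_iff.1 hF).2
    linarith
  refine le_antisymm (le_of_forall_pos_le_add fun e he ↦ hup e he)
    (le_of_forall_pos_le_add fun e he ↦ ?_)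
  have := hlow e he
  linarith

end Proof

section Statement

open Filter Topology Set
open Literature.Probability.RandomPlanarGeometry
open Literature.Probability.Percolation (bondDomainCrossingProb)

/-- **stub_rectilinearSandwich (A) of line `registered`, crux `SimilarityUpgrade`
(stmt-CriticalPhenomena-4597)** — port of
`Theorems.RectilinearApproximation.cardyFormulaZ2_of_rectilinearCardy` with `f` for Cardy's `F`.
If the bond-`ℤ²` crossing probability of every conformal rectangle converges (to `Φ`), `f` is
continuous on `(0,1)` with `f η + f (1 - η) = 1`, and `Φ R = f (crossRatio x)` for every
RECTILINEAR `R` and every uniformizing datum, then `Φ R = f (crossRatio x)` for EVERY conformal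
rectangle and every uniformizing datum (`factors_of_rectilinear`: Radó continuity of `f ∘ η`,
cyclic flip of the modulus, Bollobás–Riordan sandwich with rectilinear approximants of the
comparison quads). [cite: BollobasRiordan2006, Ch. 7 Claim 19 and remark p. 195] -/
theorem stub_rectilinearSandwich :
    ∀ (Φ : ConformalRectangle → ℝ) (f : ℝ → ℝ),
      (∀ R : ConformalRectangle, Tendsto (bondDomainCrossingProb R) (𝓝[>] (0 : ℝ)) (𝓝 (Φ R))) →
      ContinuousOn f (Ioo 0 1) →
      (∀ η ∈ Ioo (0 : ℝ) 1, f η + f (1 - η) = 1) →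
      (∀ R : ConformalRectangle,
        (∃ S : Finset (ℂ × ℂ), (∀ p ∈ S, p.1.re = p.2.re ∨ p.1.im = p.2.im) ∧
          frontier R.carrier ⊆ ⋃ p ∈ S, segment ℝ p.1 p.2) →
        ∀ (φ : ConformalEquiv UpperHalfPlane.upperHalfPlaneSet R.carrier) (x : Fin 4 → ℝ),
          R.IsUniformizing φ x → Φ R = f (crossRatio x)) →
      ∀ (R : ConformalRectangle)
        (φ : ConformalEquiv UpperHalfPlane.upperHalfPlaneSet R.carrier) (x : Fin 4 → ℝ),
        R.IsUniformizing φ x → Φ R = f (crossRatio x) :=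
  fun _ _ hlim hf hsymm hfact R φ x hux ↦ factors_of_rectilinear hlim hf hsymm hfact R φ x hux

end Statement

end Summit.CriticalPhenomena.CardyFormulaZ2.Cruxes.SimilarityUpgrade.Stubs

end
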